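import Summits.HubbardSuperconductivity.HubbardSuperconductivity.Theorems.LevyLogBootstrapLevyTransportInfraredBound
import Literature.Probability.LatticeModels.TorusBlockKernelInfraredFloor
import HarnessLib

/-!
# Crux `LevyTransport` (stmt-HubbardSuperconductivity-15049, route `LevyLogBootstrap`), input (c):
# the POINTWISE block anchor follows from input (a) and Cesàro long-range order

The log-bootstrap of `Cruxes/LevyTransport/Lines/birth.lean` (`stub_logBootstrap`) names four inputs;
input (c) is "a POINTWISE planar-order anchor `min_X K_b(X) ≥ c₀` at `Δ = 0` uniformly in `M`"
(route text: "expected (RP monotonicity) but unprinted"). This file shows that (c) is NOT an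
independent input: for every block size `b` (`M = b·m` even, `M ≥ 4`), every `Δ ≤ 0` and every
normalised `S^z_tot = 0` sector ground state `ψ` of `H_M(Δ) = xxzHamiltonian 1 (torusGraph 2 M) (-1) Δ`,
with the route's kernel `K_ψ(x,y) = Re⟨ψ, S⁺_x S⁻_y ψ⟩`, its order-parameter sum
`Λ_ψ = Σ_{x,y} K_ψ(x,y)` (`= Re⟨ψ, S⁺_tot S⁻_tot ψ⟩`) and coarse block kernel
`k_b(X) = Σ_{block x' = X, block y' = 0} K_ψ(x',y')`:

  `k_b(X) ≥ b⁴ Λ_ψ / M⁴ - 18 √(1-Δ) · b³`   for every coarse site `X`   (`sectorGS_coarseKernel_floor`).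

Hence Cesàro long-range order `Λ_ψ ≥ a M⁴` (at `Δ = 0`: Kennedy–Lieb–Shastry, in the tree as
`AnisotropyChord.sectorAnchorXY_proof`; on `[-0.109, 0]`: `halfFilledOrder_window`) gives the uniform
POSITIVE pointwise floor `k_b(X) ≥ (a/2) b⁴` for every block size `b ≥ 36√(1-Δ)/a`, which is the
hypothesis `hlow` of `levyMass_le_of_pointwise_lower` (`…LevyTransportLogBootstrapInputs.lean`) at
that block size. Ingredients: the generic block floor of
`Literature/Probability/LatticeModels/TorusBlockKernel{Floor,Remainder,InfraredFloor,Flatness}.lean`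
(Bochner floor `K_b ≥ 2b⁴Λ/M⁴ - K_b(0,0)` by one PSD test vector; incoherent remainder
`≤ 18 B b³` under `Re κ̂(k) ≤ B/√ε(k)`), fed with: translation invariance of `K_ψ`
(`gs_transverseKernel_translate`), its symmetry (`re_expect_raiseLower_symm`), its Gram positivity
(`transverse_quadForm_nonneg`, here), and input (a) PROVED in the tree
(`sectorGS_transverse_infraredBound`: `K̂_ψ(q)² ε(q) ≤ 1 - Δ`, `K̂_ψ ≥ 0`, i.e. `B = √(1-Δ)`).

Sources: T. Kennedy, E. H. Lieb, B. S. Shastry, J. Stat. Phys. 53 (1988) 1019 and Phys. Rev. Lett.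
61 (1988) 2582 (infrared bound, long-range order at `T = 0`); J. E. Björnberg, D. Ueltschi (2022),
arXiv:2204.12896, Lemma 4.4 (the bound consumed through `sectorGS_transverse_infraredBound`).
No definition is introduced; sorry-free.
-/

noncomputable section

set_option linter.dupNamespace false

namespace Summit.HubbardSuperconductivity.HubbardSuperconductivity.Theorems.LevyLogBootstrap

open scoped BigOperators Matrix ComplexOrder ComplexConjugate
open Matrix Finset Complex
open Literature.MathematicalPhysics.QuantumLattice Literature.Probability.LatticeModels

/-! ### Bilinearity and Gram positivity of two-point expectations -/

section Gram

variable {Λ : Type*} [Fintype Λ] [DecidableEq Λ] {q : ℕ}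

/-- **Bilinearity of two-point expectations**: for real weights `c, d` and one-site matrices `A, B`,
`Re⟨ψ, (Σ_x c_x A_x)(Σ_y d_y B_y) ψ⟩ = Σ_{x,y} c_x d_y Re⟨ψ, A_x B_y ψ⟩`. [folklore] -/
theorem re_expect_sum_smul_mul_sum_smul (ψ : TensorIndex Λ q → ℂ) (A B : Matrix (Fin q) (Fin q) ℂ)
    (c d : Λ → ℝ) :
    (star ψ ⬝ᵥ ((∑ x, (c x : ℂ) • onSite x A) * (∑ y, (d y : ℂ) • onSite y B)) *ᵥ ψ).re =
      ∑ x, ∑ y, c x * d y * (star ψ ⬝ᵥ (onSite x A * onSite y B) *ᵥ ψ).re := by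
  have hmul : (∑ x, (c x : ℂ) • onSite x A) * (∑ y, (d y : ℂ) • onSite y B) =
      ∑ x, ∑ y, ((c x : ℂ) * (d y : ℂ)) • (onSite x A * onSite y B) := by
    rw [Finset.sum_mul_sum]
    refine Finset.sum_congr rfl fun x _ => Finset.sum_congr rfl fun y _ => ?_
    rw [smul_mul_assoc, mul_smul_comm, smul_smul]
  rw [hmul]
  have hmv : (∑ x, ∑ y, ((c x : ℂ) * (d y : ℂ)) • (onSite x A * onSite y B)) *ᵥ ψ =
      ∑ x, ∑ y, ((c x : ℂ) * (d y : ℂ)) • ((onSite x A * onSite y B) *ᵥ ψ) := by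
    rw [Matrix.sum_mulVec]
    refine Finset.sum_congr rfl fun x _ => ?_
    rw [Matrix.sum_mulVec]
    refine Finset.sum_congr rfl fun y _ => ?_
    rw [Matrix.smul_mulVec]
  rw [hmv, dotProduct_sum, Complex.re_sum]
  refine Finset.sum_congr rfl fun x _ => ?_
  rw [dotProduct_sum, Complex.re_sum]
  refine Finset.sum_congr rfl fun y _ => ?_
  rw [dotProduct_smul, smul_eq_mul, ← Complex.ofReal_mul, Complex.re_ofReal_mul]

/-- **Gram positivity of the transverse kernel**: for every vector `ψ` and real test function `c`,
`0 ≤ Σ_{x,y} c_x c_y Re⟨ψ, S⁺_x S⁻_y ψ⟩` — it is `‖(Σ_y c_y S⁻_y) ψ‖²`, since `S⁺ = (S⁻)†`. In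
particular the route's kernel `K_ψ` is a positive-semidefinite kernel. [folklore] -/
theorem transverse_quadForm_nonneg (n : ℕ) (ψ : TensorIndex Λ (n + 1) → ℂ) (c : Λ → ℝ) :
    0 ≤ ∑ x, ∑ y, c x * c y *
      (star ψ ⬝ᵥ (onSite x (spinRaise n) * onSite y (spinLower n)) *ᵥ ψ).re := by
  set R : Op Λ (n + 1) := ∑ y, (c y : ℂ) • onSite y (spinLower n) with hR
  have hRH : Rᴴ = ∑ x, (c x : ℂ) • onSite x (spinRaise n) := by
    rw [hR, conjTranspose_sum]
    refine Finset.sum_congr rfl fun x _ => ?_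
    rw [conjTranspose_smul, ← onSite_conjTranspose, spinLower_eq_conjTranspose,
      conjTranspose_conjTranspose]
    congr 1
    exact Complex.conj_ofReal _
  rw [← re_expect_sum_smul_mul_sum_smul ψ (spinRaise n) (spinLower n) c c, ← hRH, ← hR,
    ← mulVec_mulVec, dotProduct_mulVec, ← star_mulVec]
  -- `Re (star (Rψ) ⬝ᵥ (Rψ)) ≥ 0`
  have h : 0 ≤ star (R *ᵥ ψ) ⬝ᵥ (R *ᵥ ψ) := dotProduct_star_self_nonneg _
  exact (Complex.nonneg_iff.1 h).1

end Gram

/-! ### Input (c) from input (a): the pointwise block anchor -/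

section Main

variable (M : ℕ) {m b : ℕ} [NeZero M] [NeZero m]

/-- The Fourier transform of the route's difference kernel `z ↦ Re⟨ψ, S⁺_0 S⁻_z ψ⟩` has real part the
cosine transform `Σ_z cos(q·z) Re⟨ψ, S⁺_z S⁻_0 ψ⟩` of `sectorGS_transverse_infraredBound`
(`Re χ_q(z) = cos(q·z)`, `QuantumLattice.torusChar_re`, and symmetry of the kernel). [folklore] -/
theorem re_torusFourier_transverse_eq (ψ : TensorIndex (TorusSite 2 M) 2 → ℂ) (q : TorusSite 2 M) :
    (torusFourier (fun z : TorusSite 2 M =>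
        (((star ψ ⬝ᵥ (onSite 0 (spinRaise 1) * onSite z (spinLower 1)) *ᵥ ψ).re : ℝ) : ℂ)) q).re =
      ∑ z : TorusSite 2 M, Real.cos (torusPhase M q z) *
        (star ψ ⬝ᵥ (onSite z (spinRaise 1) * onSite 0 (spinLower 1)) *ᵥ ψ).re := by
  rw [torusFourier_eq_sum_torusChar, Complex.re_sum]
  refine Finset.sum_congr rfl fun z _ => ?_
  have hc : (torusChar q z).re = Real.cos (torusPhase M q z) :=
    Literature.MathematicalPhysics.QuantumLattice.torusChar_re M q z
  rw [Complex.re_ofReal_mul, Complex.conj_re, hc, re_expect_raiseLower_symm 1 ψ 0 z, mul_comm]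

/-- **Input (c) of `LevyTransport` from input (a) + long-range order.** For `M = b·m` even, `M ≥ 4`,
`Δ ≤ 0` and every normalised `S^z_tot = 0` sector ground state `ψ` of `H_M(Δ)`: every entry of the
coarse `b`-block transverse kernel is bounded below by the coherent order-parameter term minus an
`M`-uniform `O(b³)` remainder,
`k_b(X) ≥ b⁴ (Σ_{x,y} Re⟨ψ,S⁺_xS⁻_yψ⟩)/M⁴ - 18 √(1-Δ) b³`.
(`TorusBlock.coarseKernel_floor_of_infraredBound` with translation invariance
`gs_transverseKernel_translate`, symmetry `re_expect_raiseLower_symm`, Gram positivity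
`transverse_quadForm_nonneg`, and the infrared bound `sectorGS_transverse_infraredBound`,
`B = √(1-Δ)`.) With `Σ_{x,y} K_ψ ≥ a M⁴` this is `≥ (a/2) b⁴ > 0` as soon as `b ≥ 36√(1-Δ)/a`.
[cite: KLS1988JSP, eqs. (17)–(19)] [cite: BjornbergUeltschi2022, Lemma 4.4] -/
theorem sectorGS_coarseKernel_floor (hMb : M = b * m) (hEven : Even M) (h4 : 4 ≤ M) {Δ : ℝ}
    (hΔ : Δ ≤ 0) (ψ : TensorIndex (TorusSite 2 M) 2 → ℂ)
    (hψ : ψ ∈ @spinZSector (TorusSite 2 M) _ _ 1 0) (hnorm : star ψ ⬝ᵥ ψ = 1)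
    (heig : Matrix.mulVec (xxzHamiltonian 1 (torusGraph 2 M) (-1) Δ) ψ =
      ((lowestEnergyInSector 1 (xxzHamiltonian 1 (torusGraph 2 M) (-1) Δ) 0 : ℝ) : ℂ) • ψ)
    (X : TorusSite 2 m) :
    (b : ℝ) ^ 4 * (∑ x : TorusSite 2 M, ∑ y : TorusSite 2 M,
        (star ψ ⬝ᵥ (onSite x (spinRaise 1) * onSite y (spinLower 1)) *ᵥ ψ).re) / (M : ℝ) ^ 4 -
        18 * Real.sqrt (1 - Δ) * (b : ℝ) ^ 3 ≤
      ∑ x' : TorusSite 2 M, ∑ y' : TorusSite 2 M,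
        if (∀ i : Fin 2, (x' i).val / b = (X i).val) ∧ (∀ i : Fin 2, (y' i).val / b = 0)
        then (star ψ ⬝ᵥ (onSite x' (spinRaise 1) * onSite y' (spinLower 1)) *ᵥ ψ).re else 0 := by
  set K : TorusSite 2 M → TorusSite 2 M → ℝ := fun x y =>
    (star ψ ⬝ᵥ (onSite x (spinRaise 1) * onSite y (spinLower 1)) *ᵥ ψ).re with hK
  have hT : ∀ v x y : TorusSite 2 M, K (x + v) (y + v) = K x y := fun v x y =>
    gs_transverseKernel_translate M hEven Δ ψ hψ hnorm heig v x y
  have hS : ∀ x y : TorusSite 2 M, K x y = K y x := fun x y => re_expect_raiseLower_symm 1 ψ x y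
  have hP : ∀ c : TorusSite 2 M → ℝ, 0 ≤ ∑ x, ∑ y, c x * c y * K x y := fun c =>
    transverse_quadForm_nonneg 1 ψ c
  have hIR : ∀ k : TorusSite 2 M, k ≠ 0 →
      (torusFourier (fun z => (K 0 z : ℂ)) k).re ≤
        Real.sqrt (1 - Δ) / Real.sqrt (dispersion (latticeMomentum M k)) := by
    intro k hk
    obtain ⟨h0, h1⟩ := sectorGS_transverse_infraredBound M hEven h4 hΔ ψ hψ hnorm heig k hk
    have hre := re_torusFourier_transverse_eq M ψ k
    simp only [hK]
    rw [hre]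
    set Khat : ℝ := ∑ z : TorusSite 2 M, Real.cos (torusPhase M k z) *
      (star ψ ⬝ᵥ (onSite z (spinRaise 1) * onSite 0 (spinLower 1)) *ᵥ ψ).re
    set E : ℝ := dispersion (latticeMomentum M k) with hE
    have hE0 : 0 < E := by
      rcases (dispersion_nonneg (latticeMomentum M k)).lt_or_eq with h | h
      · exact h
      · exact absurd ((dispersion_latticeMomentum_eq_zero_iff_holds (d := 2) (L := M) k).1 h.symm) hk
    have hsq : Khat ^ 2 ≤ (1 - Δ) / E := by rwa [le_div_iff₀ hE0]
    calc Khat ≤ Real.sqrt ((1 - Δ) / E) := Real.le_sqrt_of_sq_le hsq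
      _ = Real.sqrt (1 - Δ) / Real.sqrt E := Real.sqrt_div' _ hE0.le
  exact TorusBlock.coarseKernel_floor_of_infraredBound hMb K hT hS hP (Real.sqrt (1 - Δ))
    (Real.sqrt_nonneg _) hIR X

/-- **The order-parameter sum is the planar order parameter**:
`Σ_{x,y} Re⟨ψ, S⁺_x S⁻_y ψ⟩ = Re⟨ψ, S⁺_tot S⁻_tot ψ⟩` (the quantity of `HalfFilledOrder`).
[folklore] -/
theorem sum_sum_transverseKernel_eq {Λ : Type*} [Fintype Λ] [DecidableEq Λ] (n : ℕ)
    (ψ : TensorIndex Λ (n + 1) → ℂ) :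
    ∑ x, ∑ y, (star ψ ⬝ᵥ (onSite x (spinRaise n) * onSite y (spinLower n)) *ᵥ ψ).re =
      (star ψ ⬝ᵥ ((∑ x, onSite x (spinRaise n)) * (∑ y, onSite y (spinLower n))) *ᵥ ψ).re := by
  have h := re_expect_sum_smul_mul_sum_smul ψ (spinRaise n) (spinLower n) (fun _ => 1) (fun _ => 1)
  simp only [Complex.ofReal_one, one_smul, one_mul] at h
  exact h.symm

/-- `∀`-closed form on the route's interval: for even `M = b·m ≥ 4`, `Δ ∈ [-1, 0]`, every normalised
half-filled sector ground state and every coarse site `X`,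
`k_b(X) ≥ b⁴ Re⟨ψ, S⁺_tot S⁻_tot ψ⟩ / M⁴ - 18√2 · b³` (`√(1-Δ) ≤ √2`). So an `M`-uniform planar
order `Re⟨ψ, S⁺_tot S⁻_tot ψ⟩ ≥ a M⁴` yields `min_X k_b(X) ≥ (a/2) b⁴` for all `b ≥ 51/a ≥ 36√2/a`:
input (c) of the log-bootstrap at block size `b`. [cite: KLS1988JSP, eqs. (17)–(19)] -/
theorem sectorGS_coarseKernel_floor_uniform :
    ∀ (M : ℕ) [NeZero M] (m b : ℕ) [NeZero m], M = b * m → Even M → 4 ≤ M →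
      ∀ Δ ∈ Set.Icc (-1 : ℝ) 0, ∀ (ψ : TensorIndex (TorusSite 2 M) 2 → ℂ),
      ψ ∈ @spinZSector (TorusSite 2 M) _ _ 1 0 → star ψ ⬝ᵥ ψ = 1 →
      Matrix.mulVec (xxzHamiltonian 1 (torusGraph 2 M) (-1) Δ) ψ =
        ((lowestEnergyInSector 1 (xxzHamiltonian 1 (torusGraph 2 M) (-1) Δ) 0 : ℝ) : ℂ) • ψ →
      ∀ X : TorusSite 2 m,
        (b : ℝ) ^ 4 * (star ψ ⬝ᵥ ((∑ x : TorusSite 2 M, onSite x (spinRaise 1)) *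
            (∑ y : TorusSite 2 M, onSite y (spinLower 1))) *ᵥ ψ).re / (M : ℝ) ^ 4 -
          18 * Real.sqrt 2 * (b : ℝ) ^ 3 ≤
        ∑ x' : TorusSite 2 M, ∑ y' : TorusSite 2 M,
          if (∀ i : Fin 2, (x' i).val / b = (X i).val) ∧ (∀ i : Fin 2, (y' i).val / b = 0)
          then (star ψ ⬝ᵥ (onSite x' (spinRaise 1) * onSite y' (spinLower 1)) *ᵥ ψ).re else 0 := by
  intro M _ m b _ hMb hEven h4 Δ hΔ ψ hψ hnorm heig X
  have h := sectorGS_coarseKernel_floor M hMb hEven h4 hΔ.2 ψ hψ hnorm heig X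
  rw [sum_sum_transverseKernel_eq] at h
  have hs : Real.sqrt (1 - Δ) ≤ Real.sqrt 2 := Real.sqrt_le_sqrt (by linarith [hΔ.1])
  have hb : (0 : ℝ) ≤ (b : ℝ) ^ 3 := by positivity
  nlinarith [mul_le_mul_of_nonneg_right hs hb]


end Main

end Summit.HubbardSuperconductivity.HubbardSuperconductivity.Theorems.LevyLogBootstrap
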